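import Mathlib.Analysis.Distribution.TestFunction
import Mathlib.Analysis.Calculus.ContDiff.Bounds

/-!
# Smooth operations on test functions: pairing with a smooth function, precomposition with a cutoff

Two continuous linear operations on Mathlib's test functions `𝓓(Ω, G) = TestFunction Ω G ⊤`
(and on the steps `𝓓_K(E, G) = ContDiffMapSupportedIn E G ⊤ K` of the inductive limit), which
Mathlib (as of 2026-08) does not provide and on which the pull-back of test forms / push-forward of
currents `f_#` [Federer1969, 4.1.7] rests:

* `TestFunction.bilinSmoothCLM B hg : 𝓓(Ω, G) →L[ℝ] 𝓓(Ω, G₂)`, `φ ↦ (x ↦ B (g x) (φ x))`, for a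
  continuous bilinear map `B : F₁ →L G →L G₂` and a smooth `g : E → F₁` — multiplication by a
  smooth function (`B = lsmul`), pointwise application of a smooth field of operators
  (`B = apply`), …; supports do not grow (`tsupport_bilinSmoothCLM_subset`).
* `TestFunction.smulCompCLM χ hf : 𝓓(Ω', G) →L[ℝ] 𝓓(Ω, G)`, `φ ↦ χ • (φ ∘ f)`, for a smooth map
  `f : E → E'` and a cutoff `χ ∈ 𝓓(Ω, ℝ)` — precomposition with an arbitrary smooth map made
  compactly supported by the cutoff (Federer's `T(γ · f^# φ)` device in 4.1.7 for maps that are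
  not proper); `tsupport ⊆ tsupport χ ∩ f⁻¹(tsupport φ)`.

Continuity is proved through the seminorm description of the topology of `𝓓_K`
(`ContDiffMapSupportedIn.withSeminorms`, `WithSeminorms.continuous_of_isBounded`) and the universal
property of the inductive limit (`TestFunction.mkCLM`), from two quantitative calculus estimates
of Mathlib: the Leibniz bound `ContinuousLinearMap.norm_iteratedFDeriv_le_of_bilinear` and the
Faà di Bruno bound `norm_iteratedFDeriv_comp_le`; the resulting estimates are
`seminorm_bilinSmoothLM_le` (`N_i(B(g,φ)) ≤ ‖B‖ Σ_j C(i,j) sup_K‖D^j g‖ · max_{k≤i} N_k(φ)`) and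
`seminorm_smulCompLM_le` (`N_i(χ • φ∘f) ≤ C_i(χ, f, K) · max_{k≤i} N_k(φ)`).

Definitions here are operations (continuous linear maps with explicit formulas, `_apply` lemmas
by `rfl`), not named facts.

## References

* H. Federer, *Geometric Measure Theory*, Springer 1969, 4.1.1, 4.1.7 [Federer1969].
* L. Hörmander, *The Analysis of Linear Partial Differential Operators I*, 2nd ed., Springer 1990,
  Thm. 2.2.5 ff. (operations on 𝓓) [folklore].
-/

noncomputable section

open Set Function Filter TopologicalSpace
open scoped Distributions ContDiff Topology NNReal

namespace Literature.Geometry.GeometricMeasureTheory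

section Bilin

variable {E F₁ G G₂ : Type*} [NormedAddCommGroup E] [NormedSpace ℝ E]
  [NormedAddCommGroup F₁] [NormedSpace ℝ F₁] [NormedAddCommGroup G] [NormedSpace ℝ G]
  [NormedAddCommGroup G₂] [NormedSpace ℝ G₂]

/-! ### Uniform bounds for the derivatives of a smooth function on a compact set -/

/-- On a compact set, each derivative of a smooth function is bounded; `derivBound g K j` is such
a bound for the `j`-th derivative (the supremum of `‖D^j g‖` over `K`, or `0` if `K = ∅`).
[folklore] -/
def derivBound (g : E → F₁) (K : Set E) (j : ℕ) : ℝ :=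
  sSup ((fun x => ‖iteratedFDeriv ℝ j g x‖) '' K)

/-- `derivBound` is nonnegative. [folklore] -/
theorem derivBound_nonneg (g : E → F₁) (K : Set E) (j : ℕ) : 0 ≤ derivBound g K j := by
  apply Real.sSup_nonneg
  rintro _ ⟨x, -, rfl⟩
  exact norm_nonneg _

/-- `‖D^j g x‖ ≤ derivBound g K j` on the compact `K`. [folklore] -/
theorem norm_iteratedFDeriv_le_derivBound {g : E → F₁} {K : Set E} (hK : IsCompact K)
    (hg : ContDiff ℝ ∞ g) (j : ℕ) {x : E} (hx : x ∈ K) :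
    ‖iteratedFDeriv ℝ j g x‖ ≤ derivBound g K j := by
  have hc : Continuous fun x => ‖iteratedFDeriv ℝ j g x‖ :=
    (hg.continuous_iteratedFDeriv (mod_cast le_top)).norm
  exact le_csSup (hK.bddAbove_image hc.continuousOn) (mem_image_of_mem _ hx)

omit [NormedAddCommGroup E] [NormedSpace ℝ E] in
/-- The support of `x ↦ B (g x) (φ x)` lies in that of `φ`. [folklore] -/
theorem support_bilin_subset {E : Type*} (B : F₁ →L[ℝ] G →L[ℝ] G₂) (g : E → F₁) (φ : E → G) :
    support (fun x => B (g x) (φ x)) ⊆ support φ := by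
  intro x hx
  contrapose! hx
  simp [notMem_support.1 hx]

/-! ### Pairing a `𝓓_K` function with a smooth function through a bilinear map -/

namespace ContDiffMapSupportedIn

variable {K : Compacts E}

/-- `φ ↦ (x ↦ B (g x) (φ x))` on `𝓓_K(E, G)`, for a continuous bilinear `B` and a smooth `g`
(multiplication by a smooth function, pointwise application of a smooth operator field, …), as a
linear map into `𝓓_K(E, G₂)`. [folklore] -/
def bilinSmoothLM (B : F₁ →L[ℝ] G →L[ℝ] G₂) {g : E → F₁} (hg : ContDiff ℝ ∞ g) :
    𝓓_{K}(E, G) →ₗ[ℝ] 𝓓_{K}(E, G₂) where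
  toFun φ := ⟨fun x => B (g x) (φ x), (B.contDiff.comp hg).clm_apply φ.contDiff, fun x hx => by
    simp [φ.zero_on_compl hx]⟩
  map_add' φ ψ := by
    ext x
    show B (g x) (φ x + ψ x) = B (g x) (φ x) + B (g x) (ψ x)
    exact map_add _ _ _
  map_smul' c φ := by
    ext x
    show B (g x) (c • φ x) = c • B (g x) (φ x)
    exact map_smul _ _ _

/-- Formula for `bilinSmoothLM`. [folklore] -/
@[simp] theorem bilinSmoothLM_apply (B : F₁ →L[ℝ] G →L[ℝ] G₂) {g : E → F₁} (hg : ContDiff ℝ ∞ g)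
    (φ : 𝓓_{K}(E, G)) (x : E) : bilinSmoothLM B hg φ x = B (g x) (φ x) := rfl

/-- The seminorm estimate making `bilinSmoothLM` continuous (Leibniz rule):
`N_i(B(g, φ)) ≤ ‖B‖ (Σ_{j ≤ i} C(i,j) sup_K ‖D^j g‖) · max_{k ≤ i} N_k(φ)`. [folklore] -/
theorem seminorm_bilinSmoothLM_le (B : F₁ →L[ℝ] G →L[ℝ] G₂) {g : E → F₁} (hg : ContDiff ℝ ∞ g)
    (i : ℕ) (φ : 𝓓_{K}(E, G)) :
    ContDiffMapSupportedIn.seminorm ℝ E G₂ ⊤ K i (bilinSmoothLM B hg φ) ≤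
      (‖B‖ * ∑ j ∈ Finset.range (i + 1), (i.choose j : ℝ) * derivBound g K j) *
        (Finset.Iic i).sup (ContDiffMapSupportedIn.seminorm ℝ E G ⊤ K) φ := by
  set S := (Finset.Iic i).sup (ContDiffMapSupportedIn.seminorm ℝ E G ⊤ K) φ with hS
  have hS0 : 0 ≤ S := apply_nonneg _ _
  have hC0 : 0 ≤ ‖B‖ * ∑ j ∈ Finset.range (i + 1), (i.choose j : ℝ) * derivBound g K j :=
    mul_nonneg (norm_nonneg B) (Finset.sum_nonneg fun j _ =>
      mul_nonneg (Nat.cast_nonneg _) (derivBound_nonneg _ _ _))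
  rw [ContDiffMapSupportedIn.seminorm_top_le_iff ℝ (mul_nonneg hC0 hS0)]
  intro x hx
  have hle := B.norm_iteratedFDeriv_le_of_bilinear hg φ.contDiff x (n := i) (mod_cast le_top)
  refine hle.trans ?_
  rw [mul_assoc, Finset.sum_mul]
  refine mul_le_mul_of_nonneg_left (Finset.sum_le_sum fun j _ => ?_) (norm_nonneg B)
  rw [mul_assoc, mul_assoc]
  refine mul_le_mul_of_nonneg_left ?_ (Nat.cast_nonneg _)
  refine mul_le_mul (norm_iteratedFDeriv_le_derivBound K.isCompact hg j hx) ?_ (norm_nonneg _)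
    (derivBound_nonneg _ _ _)
  calc ‖iteratedFDeriv ℝ (i - j) φ x‖
      ≤ ContDiffMapSupportedIn.seminorm ℝ E G ⊤ K (i - j) φ :=
        ContDiffMapSupportedIn.norm_iteratedFDeriv_apply_le_seminorm ℝ (mod_cast le_top)
    _ ≤ S := by
        have h : ContDiffMapSupportedIn.seminorm ℝ E G ⊤ K (i - j) ≤
            (Finset.Iic i).sup (ContDiffMapSupportedIn.seminorm ℝ E G ⊤ K) :=
          Finset.le_sup (f := ContDiffMapSupportedIn.seminorm ℝ E G ⊤ K)
            (Finset.mem_Iic.2 (Nat.sub_le i j))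
        exact h φ

/-- `φ ↦ B(g, φ)` as a continuous linear map `𝓓_K(E, G) →L 𝓓_K(E, G₂)`. [folklore] -/
def bilinSmoothCLM (B : F₁ →L[ℝ] G →L[ℝ] G₂) {g : E → F₁} (hg : ContDiff ℝ ∞ g) :
    𝓓_{K}(E, G) →L[ℝ] 𝓓_{K}(E, G₂) where
  toLinearMap := bilinSmoothLM B hg
  cont := show Continuous (bilinSmoothLM (K := K) B hg) from
    WithSeminorms.continuous_of_isBounded (ContDiffMapSupportedIn.withSeminorms ℝ E G ⊤ K)
      (ContDiffMapSupportedIn.withSeminorms ℝ E G₂ ⊤ K) _ (.of_real fun i => ⟨Finset.Iic i,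
        ‖B‖ * ∑ j ∈ Finset.range (i + 1), (i.choose j : ℝ) * derivBound g K j, fun φ =>
          seminorm_bilinSmoothLM_le B hg i φ⟩)

/-- Formula for `bilinSmoothCLM` on `𝓓_K`. [folklore] -/
@[simp] theorem bilinSmoothCLM_apply (B : F₁ →L[ℝ] G →L[ℝ] G₂) {g : E → F₁}
    (hg : ContDiff ℝ ∞ g) (φ : 𝓓_{K}(E, G)) (x : E) :
    bilinSmoothCLM B hg φ x = B (g x) (φ x) := rfl

end ContDiffMapSupportedIn

/-! ### The same on test functions `𝓓(Ω, G)` -/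

namespace TestFunction

variable {Ω : Opens E}

/-- The test function `x ↦ B (g x) (φ x)` (raw form of `bilinSmoothCLM`). [folklore] -/
def bilinSmooth (B : F₁ →L[ℝ] G →L[ℝ] G₂) {g : E → F₁} (hg : ContDiff ℝ ∞ g) (φ : 𝓓(Ω, G)) :
    𝓓(Ω, G₂) :=
  ⟨fun x => B (g x) (φ x), (B.contDiff.comp hg).clm_apply φ.contDiff,
    φ.hasCompactSupport.mono (support_bilin_subset B g φ),
    (closure_mono (support_bilin_subset B g φ)).trans φ.tsupport_subset⟩

/-- Formula for `bilinSmooth`. [folklore] -/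
@[simp] theorem bilinSmooth_apply (B : F₁ →L[ℝ] G →L[ℝ] G₂) {g : E → F₁} (hg : ContDiff ℝ ∞ g)
    (φ : 𝓓(Ω, G)) (x : E) : bilinSmooth B hg φ x = B (g x) (φ x) := rfl

/-- `φ ↦ (x ↦ B (g x) (φ x))` on test functions `𝓓(Ω, G)`, for a continuous bilinear `B` and a
smooth `g : E → F₁`: a continuous linear map `𝓓(Ω, G) →L 𝓓(Ω, G₂)` (supports can only shrink).
Special cases: multiplication by a smooth function, pointwise application of a smooth field of
operators. [folklore] -/
def bilinSmoothCLM (B : F₁ →L[ℝ] G →L[ℝ] G₂) {g : E → F₁} (hg : ContDiff ℝ ∞ g) :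
    𝓓(Ω, G) →L[ℝ] 𝓓(Ω, G₂) :=
  TestFunction.mkCLM ℝ (bilinSmooth B hg)
    (fun φ ψ => by
      ext x
      show B (g x) (φ x + ψ x) = B (g x) (φ x) + B (g x) (ψ x)
      exact map_add _ _ _)
    (fun c φ => by
      ext x
      show B (g x) (c • φ x) = c • B (g x) (φ x)
      exact map_smul _ _ _)
    (fun K hK => by
      have : bilinSmooth (Ω := Ω) B hg ∘ TestFunction.ofSupportedIn hK =
          TestFunction.ofSupportedIn hK ∘ ContDiffMapSupportedIn.bilinSmoothCLM (K := K) B hg := by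
        funext φ; rfl
      rw [this]
      exact (TestFunction.continuous_ofSupportedIn hK).comp
        (ContDiffMapSupportedIn.bilinSmoothCLM B hg).cont)

/-- Formula for `bilinSmoothCLM` on `𝓓(Ω, G)`. [folklore] -/
@[simp] theorem bilinSmoothCLM_apply (B : F₁ →L[ℝ] G →L[ℝ] G₂) {g : E → F₁}
    (hg : ContDiff ℝ ∞ g) (φ : 𝓓(Ω, G)) (x : E) :
    bilinSmoothCLM B hg φ x = B (g x) (φ x) := rfl

/-- `bilinSmoothCLM` does not increase supports. [folklore] -/
theorem tsupport_bilinSmoothCLM_subset (B : F₁ →L[ℝ] G →L[ℝ] G₂) {g : E → F₁}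
    (hg : ContDiff ℝ ∞ g) (φ : 𝓓(Ω, G)) :
    tsupport ⇑(bilinSmoothCLM B hg φ) ⊆ tsupport ⇑φ :=
  closure_mono (support_bilin_subset B g φ)

end TestFunction

end Bilin

section Comp


variable {E E' G : Type*} [NormedAddCommGroup E] [NormedSpace ℝ E]
  [NormedAddCommGroup E'] [NormedSpace ℝ E'] [NormedAddCommGroup G] [NormedSpace ℝ G]

/-- A common bound `D ≥ 1` for the derivatives of orders `1, …, i` of `f` on `K`. [folklore] -/
def derivBoundMax (f : E → E') (K : Set E) (i : ℕ) : ℝ :=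
  max 1 ((Finset.range (i + 1)).sup' ⟨0, by simp⟩ fun l => derivBound f K l)

/-- `1 ≤ derivBoundMax`. [folklore] -/
theorem one_le_derivBoundMax (f : E → E') (K : Set E) (i : ℕ) : 1 ≤ derivBoundMax f K i :=
  le_max_left _ _

/-- `‖D^l f x‖ ≤ D_i^l` for `1 ≤ l ≤ i`, `x ∈ K`, with `D_i = derivBoundMax f K i`. [folklore] -/
theorem norm_iteratedFDeriv_le_derivBoundMax_pow {f : E → E'} {K : Set E} (hK : IsCompact K)
    (hf : ContDiff ℝ ∞ f) {i l : ℕ} (hl : 1 ≤ l) (hli : l ≤ i) {x : E} (hx : x ∈ K) :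
    ‖iteratedFDeriv ℝ l f x‖ ≤ derivBoundMax f K i ^ l := by
  have h1 := one_le_derivBoundMax f K i
  calc ‖iteratedFDeriv ℝ l f x‖ ≤ derivBound f K l := norm_iteratedFDeriv_le_derivBound hK hf l hx
    _ ≤ derivBoundMax f K i := by
        refine le_trans ?_ (le_max_right _ _)
        exact Finset.le_sup' (fun l => derivBound f K l) (Finset.mem_range.2 (by omega))
    _ = derivBoundMax f K i ^ 1 := (pow_one _).symm
    _ ≤ derivBoundMax f K i ^ l := pow_le_pow_right₀ h1 hl

namespace ContDiffMapSupportedIn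

variable {K' : Compacts E'} {K₀ : Compacts E}

/-- `φ ↦ (x ↦ χ x • φ (f x))` from `𝓓_{K'}(E', G)` to `𝓓_{K₀}(E, G)`, for a smooth map
`f : E → E'` and a smooth cutoff `χ` vanishing off `K₀`, as a linear map. [folklore] -/
def smulCompLM {χ : E → ℝ} (hχ : ContDiff ℝ ∞ χ) (hχK : support χ ⊆ K₀) {f : E → E'}
    (hf : ContDiff ℝ ∞ f) : 𝓓_{K'}(E', G) →ₗ[ℝ] 𝓓_{K₀}(E, G) where
  toFun φ := ⟨fun x => χ x • φ (f x), hχ.smul (φ.contDiff.comp hf), fun x hx => by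
    simp [notMem_support.1 fun h => hx (hχK h)]⟩
  map_add' φ ψ := by
    ext x
    show χ x • (φ (f x) + ψ (f x)) = χ x • φ (f x) + χ x • ψ (f x)
    exact smul_add _ _ _
  map_smul' c φ := by
    ext x
    show χ x • (c • φ (f x)) = c • χ x • φ (f x)
    exact smul_comm _ _ _

/-- Formula for `smulCompLM`. [folklore] -/
@[simp] theorem smulCompLM_apply {χ : E → ℝ} (hχ : ContDiff ℝ ∞ χ) (hχK : support χ ⊆ K₀)
    {f : E → E'} (hf : ContDiff ℝ ∞ f) (φ : 𝓓_{K'}(E', G)) (x : E) :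
    smulCompLM (K' := K') hχ hχK hf φ x = χ x • φ (f x) := rfl

/-- Chain-rule estimate: `‖D^k (φ ∘ f) x‖ ≤ k! · max_{l ≤ i} N_l(φ) · D_i^k` for `k ≤ i`, `x ∈ K₀`.
[folklore] -/
theorem norm_iteratedFDeriv_comp_le_seminorm {f : E → E'} (hf : ContDiff ℝ ∞ f)
    (φ : 𝓓_{K'}(E', G)) {i k : ℕ} (hk : k ≤ i) {x : E} (hx : x ∈ K₀) :
    ‖iteratedFDeriv ℝ k (⇑φ ∘ f) x‖ ≤ (k.factorial : ℝ) *
      (Finset.Iic i).sup (ContDiffMapSupportedIn.seminorm ℝ E' G ⊤ K') φ *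
        derivBoundMax f K₀ i ^ k := by
  refine norm_iteratedFDeriv_comp_le (N := ∞) φ.contDiff hf (mod_cast le_top) x
    (fun l hl => ?_) (fun l hl hlk => ?_)
  · calc ‖iteratedFDeriv ℝ l φ (f x)‖ ≤ ContDiffMapSupportedIn.seminorm ℝ E' G ⊤ K' l φ :=
          ContDiffMapSupportedIn.norm_iteratedFDeriv_apply_le_seminorm ℝ (mod_cast le_top)
      _ ≤ (Finset.Iic i).sup (ContDiffMapSupportedIn.seminorm ℝ E' G ⊤ K') φ := by
          have h : ContDiffMapSupportedIn.seminorm ℝ E' G ⊤ K' l ≤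
              (Finset.Iic i).sup (ContDiffMapSupportedIn.seminorm ℝ E' G ⊤ K') :=
            Finset.le_sup (f := ContDiffMapSupportedIn.seminorm ℝ E' G ⊤ K')
              (Finset.mem_Iic.2 (hl.trans hk))
          exact h φ
  · exact norm_iteratedFDeriv_le_derivBoundMax_pow K₀.isCompact hf hl (hlk.trans hk) hx

/-- The constant in the seminorm estimate for `smulCompLM`. [folklore] -/
def smulCompBound (χ : E → ℝ) (f : E → E') (K₀ : Set E) (i : ℕ) : ℝ :=
  ∑ j ∈ Finset.range (i + 1),
    (i.choose j : ℝ) * derivBound χ K₀ j * (((i - j).factorial : ℝ) * derivBoundMax f K₀ i ^ (i - j))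

/-- `smulCompBound` is nonnegative. [folklore] -/
theorem smulCompBound_nonneg (χ : E → ℝ) (f : E → E') (K₀ : Set E) (i : ℕ) :
    0 ≤ smulCompBound χ f K₀ i :=
  Finset.sum_nonneg fun _ _ => mul_nonneg (mul_nonneg (Nat.cast_nonneg _)
    (derivBound_nonneg _ _ _)) (mul_nonneg (Nat.cast_nonneg _)
      (pow_nonneg (zero_le_one.trans (one_le_derivBoundMax f K₀ i)) _))

/-- The seminorm estimate making `smulCompLM` continuous:
`N_i(χ • (φ ∘ f)) ≤ C_i · max_{l ≤ i} N_l(φ)`. [folklore] -/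
theorem seminorm_smulCompLM_le {χ : E → ℝ} (hχ : ContDiff ℝ ∞ χ) (hχK : support χ ⊆ K₀)
    {f : E → E'} (hf : ContDiff ℝ ∞ f) (i : ℕ) (φ : 𝓓_{K'}(E', G)) :
    ContDiffMapSupportedIn.seminorm ℝ E G ⊤ K₀ i (smulCompLM hχ hχK hf φ) ≤
      smulCompBound χ f K₀ i *
        (Finset.Iic i).sup (ContDiffMapSupportedIn.seminorm ℝ E' G ⊤ K') φ := by
  set S := (Finset.Iic i).sup (ContDiffMapSupportedIn.seminorm ℝ E' G ⊤ K') φ with hS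
  have hS0 : 0 ≤ S := apply_nonneg _ _
  rw [ContDiffMapSupportedIn.seminorm_top_le_iff ℝ (mul_nonneg (smulCompBound_nonneg _ _ _ _) hS0)]
  intro x hx
  have hle := (ContinuousLinearMap.lsmul ℝ ℝ : ℝ →L[ℝ] G →L[ℝ] G).norm_iteratedFDeriv_le_of_bilinear
    hχ (φ.contDiff.comp hf) x (n := i) (mod_cast le_top)
  have hB : ‖(ContinuousLinearMap.lsmul ℝ ℝ : ℝ →L[ℝ] G →L[ℝ] G)‖ ≤ 1 :=
    ContinuousLinearMap.opNorm_lsmul_le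
  change ‖iteratedFDeriv ℝ i (fun y => χ y • (⇑φ ∘ f) y) x‖ ≤ _
  refine hle.trans ?_
  have hsum0 : 0 ≤ ∑ j ∈ Finset.range (i + 1), (i.choose j : ℝ) * ‖iteratedFDeriv ℝ j χ x‖ *
      ‖iteratedFDeriv ℝ (i - j) (⇑φ ∘ f) x‖ :=
    Finset.sum_nonneg fun j _ => by positivity
  calc _ ≤ 1 * ∑ j ∈ Finset.range (i + 1), (i.choose j : ℝ) * ‖iteratedFDeriv ℝ j χ x‖ *
        ‖iteratedFDeriv ℝ (i - j) (⇑φ ∘ f) x‖ := mul_le_mul_of_nonneg_right hB hsum0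
    _ = _ := one_mul _
    _ ≤ ∑ j ∈ Finset.range (i + 1), (i.choose j : ℝ) * derivBound χ K₀ j *
        (((i - j).factorial : ℝ) * S * derivBoundMax f K₀ i ^ (i - j)) := by
        refine Finset.sum_le_sum fun j _ => ?_
        have hj' : i - j ≤ i := Nat.sub_le i j
        refine mul_le_mul (mul_le_mul_of_nonneg_left
          (norm_iteratedFDeriv_le_derivBound K₀.isCompact hχ j hx) (Nat.cast_nonneg _))
          (norm_iteratedFDeriv_comp_le_seminorm hf φ hj' hx) (norm_nonneg _)
          (mul_nonneg (Nat.cast_nonneg _) (derivBound_nonneg _ _ _))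
    _ = smulCompBound χ f K₀ i * S := by
        rw [smulCompBound, Finset.sum_mul]
        refine Finset.sum_congr rfl fun j _ => ?_
        ring

/-- `φ ↦ χ • (φ ∘ f)` as a continuous linear map `𝓓_{K'}(E', G) →L 𝓓_{K₀}(E, G)`. [folklore] -/
def smulCompCLM {χ : E → ℝ} (hχ : ContDiff ℝ ∞ χ) (hχK : support χ ⊆ K₀) {f : E → E'}
    (hf : ContDiff ℝ ∞ f) : 𝓓_{K'}(E', G) →L[ℝ] 𝓓_{K₀}(E, G) where
  toLinearMap := smulCompLM hχ hχK hf
  cont := show Continuous (smulCompLM (K' := K') (G := G) hχ hχK hf) from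
    WithSeminorms.continuous_of_isBounded (ContDiffMapSupportedIn.withSeminorms ℝ E' G ⊤ K')
      (ContDiffMapSupportedIn.withSeminorms ℝ E G ⊤ K₀) _ (.of_real fun i => ⟨Finset.Iic i,
        smulCompBound χ f K₀ i, fun φ => seminorm_smulCompLM_le hχ hχK hf i φ⟩)

/-- Formula for `smulCompCLM` on `𝓓_K`. [folklore] -/
@[simp] theorem smulCompCLM_apply {χ : E → ℝ} (hχ : ContDiff ℝ ∞ χ) (hχK : support χ ⊆ K₀)
    {f : E → E'} (hf : ContDiff ℝ ∞ f) (φ : 𝓓_{K'}(E', G)) (x : E) :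
    smulCompCLM (K' := K') hχ hχK hf φ x = χ x • φ (f x) := rfl

end ContDiffMapSupportedIn

namespace TestFunction

variable {Ω : Opens E} {Ω' : Opens E'}

/-- The compact support of a test function, bundled. [folklore] -/
def tsupportCompacts (χ : 𝓓(Ω, ℝ)) : Compacts E := ⟨tsupport ⇑χ, χ.hasCompactSupport⟩

/-- The test function `x ↦ χ x • φ (f x)` (raw form of `smulCompCLM`). [folklore] -/
def smulComp (χ : 𝓓(Ω, ℝ)) {f : E → E'} (hf : ContDiff ℝ ∞ f) (φ : 𝓓(Ω', G)) : 𝓓(Ω, G) :=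
  ⟨fun x => χ x • φ (f x), χ.contDiff.smul (φ.contDiff.comp hf),
    χ.hasCompactSupport.smul_right, (tsupport_smul_subset_left _ _).trans χ.tsupport_subset⟩

/-- Formula for `smulComp`. [folklore] -/
@[simp] theorem smulComp_apply (χ : 𝓓(Ω, ℝ)) {f : E → E'} (hf : ContDiff ℝ ∞ f) (φ : 𝓓(Ω', G))
    (x : E) : smulComp χ hf φ x = χ x • φ (f x) := rfl

/-- **Precomposition with a smooth map, with a cutoff.** `φ ↦ χ • (φ ∘ f)` is a continuous linear
map `𝓓(Ω', G) →L 𝓓(Ω, G)` for every smooth `f : E → E'` and every test function `χ ∈ 𝓓(Ω, ℝ)`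
(no properness of `f` is needed thanks to the cutoff; when `f` is proper and `χ = 1` on
`f⁻¹(spt φ)` this is the honest pull-back `φ ∘ f`). [folklore] -/
def smulCompCLM (χ : 𝓓(Ω, ℝ)) {f : E → E'} (hf : ContDiff ℝ ∞ f) : 𝓓(Ω', G) →L[ℝ] 𝓓(Ω, G) :=
  TestFunction.mkCLM ℝ (smulComp χ hf)
    (fun φ ψ => by
      ext x
      show χ x • (φ (f x) + ψ (f x)) = χ x • φ (f x) + χ x • ψ (f x)
      exact smul_add _ _ _)
    (fun c φ => by
      ext x
      show χ x • (c • φ (f x)) = c • χ x • φ (f x)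
      exact smul_comm _ _ _)
    (fun K' hK' => by
      have hsub : ((tsupportCompacts χ : Compacts E) : Set E) ⊆ Ω := χ.tsupport_subset
      have : smulComp (Ω' := Ω') (G := G) χ hf ∘ TestFunction.ofSupportedIn hK' =
          TestFunction.ofSupportedIn hsub ∘ ContDiffMapSupportedIn.smulCompCLM (K' := K')
            (K₀ := tsupportCompacts χ) χ.contDiff (subset_tsupport _) hf := by
        funext φ; rfl
      rw [this]
      exact (TestFunction.continuous_ofSupportedIn hsub).comp
        (ContDiffMapSupportedIn.smulCompCLM _ _ hf).cont)

/-- Formula for `smulCompCLM` on `𝓓(Ω', G)`. [folklore] -/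
@[simp] theorem smulCompCLM_apply (χ : 𝓓(Ω, ℝ)) {f : E → E'} (hf : ContDiff ℝ ∞ f)
    (φ : 𝓓(Ω', G)) (x : E) : smulCompCLM χ hf φ x = χ x • φ (f x) := rfl

/-- `spt (χ • φ∘f) ⊆ spt χ`. [folklore] -/
theorem tsupport_smulCompCLM_subset (χ : 𝓓(Ω, ℝ)) {f : E → E'} (hf : ContDiff ℝ ∞ f)
    (φ : 𝓓(Ω', G)) : tsupport ⇑(smulCompCLM χ hf φ) ⊆ tsupport ⇑χ :=
  tsupport_smul_subset_left _ _

/-- `spt (χ • φ∘f) ⊆ f⁻¹(spt φ)`. [folklore] -/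
theorem tsupport_smulCompCLM_subset_preimage (χ : 𝓓(Ω, ℝ)) {f : E → E'} (hf : ContDiff ℝ ∞ f)
    (φ : 𝓓(Ω', G)) : tsupport ⇑(smulCompCLM χ hf φ) ⊆ f ⁻¹' tsupport ⇑φ := by
  refine closure_minimal (fun x hx => ?_) ((isClosed_tsupport _).preimage hf.continuous)
  have : φ (f x) ≠ 0 := by
    intro h; exact hx (by simp [h])
  exact subset_tsupport _ this

end TestFunction

end Comp

end Literature.Geometry.GeometricMeasureTheory
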